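import Literature.NumberTheory.EllipticCurves.SzpiroOfAbcProofs
import Literature.NumberTheory.EllipticCurves.SzpiroLocalDataProofs
import Literature.NumberTheory.DiophantineGeometry.ConductorMultiplicativeProofs
import Literature.NumberTheory.EllipticCurves.Greenberg1999.TwoTorsionMuInvariant
import Literature.NumberTheory.EllipticCurves.VariableChangePoints
import Mathlib.RingTheory.Polynomial.RationalRoot
import Mathlib.Tactic.ComputeDegree
import HarnessLib

/-!
# Elliptic curves of prime conductor with a rational `2`-torsion point: the normal form `y² = x³ + Ax² + Bx`

Topic `Literature/NumberTheory/EllipticCurves`; namespace `Literature.NumberTheory.EllipticCurves`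
(lemmas in the sub-namespace `PrimeConductorTwoTorsion`). THEOREMS ONLY — no definition, no named
fact (D-0026). First half (local data and the `2`-torsion normal form) of the discharge of the named
fact `Literature.NumberTheory.EllipticCurves.Setzer1975_primeConductor_rationalTwoTorsion`
(`NeumannSetzerCurves.lean`): B. Setzer's classification of the elliptic curves over `ℚ` of PRIME
conductor with a rational point of order `2` [Setzer1975] (statement as restated in [Ivorra2004,
Introduction, Théorème, p. 5]).

## Content

* §1 `exists_intModel_of_prime_conductorNorm`: if `N_E = p` is prime, `E` has a Weierstrass equation
  `W₀` over `ℤ`, minimal at every prime, with `Δ(W₀) = ±pⁿ`, `n ≥ 1`, and `p ∤ c₄(W₀)` (the curve is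
  semistable with bad reduction exactly at `p`: Silverman AEC VII.5.1, VIII.11; tree dictionary
  `factorization_conductorNorm_primesEquiv_symm`, `conductorExponent_ne_zero_of_dvd_Δ`,
  `pow_conductorExponent_dvd_Δ`, `conductorExponent_eq_one_iff_holds`).
* §2 the `2`-torsion normal form: a rational point `P = (x₀, y₀)` of order `2` on an integral
  equation (`2y₀ + a₁x₀ + a₃ = 0`) has `ξ = 4x₀ ∈ ℤ` a root of `ξ³ + b₂ξ² + 8b₄ξ + 16b₆`
  (`cubic_eq_zero`, `exists_int_eq_four_mul`), and the substitution `x = x'/4 + x₀`,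
  `y = y'/8 − (a₁/2)(x'/4 + x₀) − … ` i.e. `C = ⟨u = 1/2, r = x₀, s = −a₁/2, t = y₀⟩` carries the
  equation to `y² = x³ + Ax² + Bx` with `A = b₂ + 3ξ`, `B = 3ξ² + 2b₂ξ + 8b₄` EXACTLY
  (`smul_eq_twoTorsionModel`); `16B²(A² − 4B) = 2¹²Δ`, `A² − 3B = c₄`.
* §3 parity: if `Δ` is odd or `c₄` is odd then `a₁` is odd (a curve supersingular at `2`,
  `a₁` even, `a₃` odd, has no rational `2`-torsion: `no_root_of_even_a₁_odd_a₃`), `b₂ ≡ 1 (mod 4)`,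
  and `ξ` is odd or `4 ∣ ξ` (`odd_or_four_dvd`); accordingly `(A, B)` is of type I
  (`A ≡ 1 (mod 4)`, `8 ∣ B`) or of type II (`B` odd, `A = 2A₁`, `A₁ ≡ 3 (mod 4)`).
* §4 `exists_normalForm_of_prime_conductorNorm`: the package used by the classification
  (`PrimeConductorTwoTorsionProofs.lean`): `C • W = ⟨0, A, 0, B, 0⟩`, `B²(A² − 4B) = ±2⁸pⁿ`,
  `n ≥ 1`, `p ∤ A² − 3B`, type I or II.

This is the standard opening of [Setzer1975] / [Ivorra2004, §2.1] (curves with a rational `2`-torsion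
point are `y² = x³ + Ax² + Bx` with `B²(A² − 4B) = 2⁸·Δ_min` up to the `2`-adic normalisation);
cf. also Cremona–Pacetti, arXiv:1711.02170 §5 (the same normal form over imaginary quadratic fields).

## References

* [Setzer1975] B. Setzer, *Elliptic curves of prime conductor*, J. London Math. Soc. (2) 10 (1975)
  367–378 (not held; acq-03412).
* [Ivorra2004] W. Ivorra, *Courbes elliptiques sur ℚ, ayant un point d'ordre 2 rationnel sur ℚ, de
  conducteur 2ᴺp*, Dissertationes Math. 429 (2004), Introduction (p. 5) and §2.1. Held:
  `paper:doi-10-4064-dm429-0-1`.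
* [SilvermanAEC2009] J. H. Silverman, *The Arithmetic of Elliptic Curves*, 2nd ed., III.1 (changes of
  variables), VII.1 Remark 1.1, VII.5 Prop. 5.1, VIII.8 Cor. 8.3, VIII.11.
-/

namespace Literature.NumberTheory.EllipticCurves

namespace PrimeConductorTwoTorsion

open WeierstrassCurve IsDedekindDomain Rat.HeightOneSpectrum Greenberg1999

/-! ## §1 Prime conductor: an integral model with `Δ = ±pⁿ` and `p ∤ c₄` -/

/-- **Prime conductor ⟹ `Δ_min = ±pⁿ`, `p ∤ c₄`.** If the conductor `N_E` of an elliptic curve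
`W/ℚ` is a prime `p`, then `W` is `ℚ`-isomorphic to an equation `W₀` with integer coefficients,
minimal at every prime, whose discriminant is `±pⁿ` with `n ≥ 1` and whose `c₄` is prime to `p`
(good reduction away from `p`, multiplicative reduction at `p`).
[cite: SilvermanAEC2009, VII.5 Prop. 5.1 and VIII.11 (with VIII.8 Cor. 8.3)] -/
theorem exists_intModel_of_prime_conductorNorm (W : WeierstrassCurve ℚ) [W.IsElliptic]
    (hN : (W.conductorNorm ℤ).Prime) :
    ∃ (C : VariableChange ℚ) (W₀ : WeierstrassCurve ℤ) (n : ℕ),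
      C • W = W₀.baseChange ℚ ∧ (∀ v : HeightOneSpectrum ℤ, (W₀.baseChange ℚ).IsMinimalAt v) ∧
      1 ≤ n ∧
      (W₀.Δ = (W.conductorNorm ℤ : ℤ) ^ n ∨ W₀.Δ = -((W.conductorNorm ℤ : ℤ) ^ n)) ∧
      ¬ ((W.conductorNorm ℤ : ℕ) : ℤ) ∣ W₀.c₄ := by
  obtain ⟨C, W₀, hCW, hmin⟩ := exists_baseChange_int_forall_isMinimalAt W
  set N := W.conductorNorm ℤ
  haveI hell : (W₀.baseChange ℚ).IsElliptic := by rw [← hCW]; infer_instance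
  have hNC : (W₀.baseChange ℚ).conductorNorm ℤ = N := by rw [← hCW, conductorNorm_smul_rat]
  -- the conductor exponents: `f_q = 1` at `q = N`, `0` elsewhere
  have hf : ∀ q : Nat.Primes,
      (W₀.baseChange ℚ).conductorExponent ((primesEquiv (R := ℤ)).symm q) =
        if (q : ℕ) = N then 1 else 0 := by
    intro q
    rw [← factorization_conductorNorm_primesEquiv_symm, hNC, hN.factorization, Finsupp.single_apply]
    by_cases h : (q : ℕ) = N
    · simp [h]
    · simp [h, Ne.symm h]
  -- every prime divisor of `Δ(W₀)` is `N`
  have hΔ0 : W₀.Δ ≠ 0 := Δ_ne_zero_of_isElliptic_baseChange_int W₀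
  have hprime_dvd : ∀ q : ℕ, q.Prime → (q : ℤ) ∣ W₀.Δ → q = N := by
    intro q hq hqd
    have hne := conductorExponent_ne_zero_of_dvd_Δ (hmin ((primesEquiv (R := ℤ)).symm ⟨q, hq⟩))
      (by rw [Literature.NumberTheory.EllipticCurves.Rat.natGenerator_primesEquiv_symm]; exact hqd)
    rw [hf ⟨q, hq⟩] at hne
    by_contra h
    exact hne (by simp [h])
  set k := W₀.Δ.natAbs.factorization N
  have hnat : W₀.Δ.natAbs = N ^ k := by
    refine Nat.eq_pow_of_factorization_eq_single (Int.natAbs_ne_zero.mpr hΔ0)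
      (Finsupp.support_subset_singleton.mp ?_)
    intro q hq
    rw [Nat.support_factorization, Nat.mem_primeFactors] at hq
    rw [Finset.mem_singleton]
    exact hprime_dvd q hq.1 (Int.natCast_dvd.mpr (by simpa using hq.2.1))
  have hΔ : W₀.Δ = (N : ℤ) ^ k ∨ W₀.Δ = -((N : ℤ) ^ k) := by
    rcases Int.natAbs_eq W₀.Δ with h | h
    · left; rw [h, hnat]; push_cast; ring
    · right; rw [h, hnat]; push_cast; ring
  -- `f_N = 1`: `N ∣ Δ` and `N ∤ c₄`
  set v : HeightOneSpectrum ℤ := (primesEquiv (R := ℤ)).symm ⟨N, hN⟩ with hvdef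
  have hvN : natGenerator v = N :=
    Literature.NumberTheory.EllipticCurves.Rat.natGenerator_primesEquiv_symm ⟨N, hN⟩
  have hf1 : (W₀.baseChange ℚ).conductorExponent v = 1 := by
    rw [hvdef, hf ⟨N, hN⟩]; simp
  have hNd : (N : ℤ) ∣ W₀.Δ := by
    have := pow_conductorExponent_dvd_Δ (hmin v)
    rw [hvN, hf1, pow_one] at this
    exact this
  have hk1 : 1 ≤ k := by
    by_contra h0
    have h0' : k = 0 := by omega
    rw [h0', pow_zero] at hnat
    have h1 : (N : ℤ) ∣ 1 := by
      have := Int.natAbs_dvd_natAbs.mpr hNd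
      rw [hnat] at this
      exact_mod_cast this
    have := Int.eq_one_of_dvd_one (by exact_mod_cast N.zero_le) h1
    have hN1 : N = 1 := by exact_mod_cast this
    exact hN.one_lt.ne' hN1
  have hc4 : ¬ (N : ℤ) ∣ W₀.c₄ := by
    have hmult := (conductorExponent_eq_one_iff_holds v (W₀.baseChange ℚ)).mp hf1
    have h2 := ((hasMultiplicativeReductionAt_iff_of_isMinimalAt (hmin v)).mp hmult).2
    rw [baseChange_int_c₄, Literature.NumberTheory.EllipticCurves.Rat.valuation_intCast_eq_one_iff,
      hvN] at h2
    exact h2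
  exact ⟨C, W₀, k, hCW, hmin, hk1, hΔ, hc4⟩

/-! ## §2 The `2`-torsion normal form -/

/-- Transport of a rational point of order `2` along a change of variables: `x' = u⁻²(x − r)`
(`2y' + a₁'x' + a₃' = u⁻³(2y + a₁x + a₃)`). [cite: SilvermanAEC2009, III.1 Table 3.1] -/
theorem hasRationalTwoTorsionX_smul (W : WeierstrassCurve ℚ) (C : VariableChange ℚ) {x : ℚ}
    (h : HasRationalTwoTorsionX W x) : HasRationalTwoTorsionX (C • W) (C.toX x) := by
  obtain ⟨y, hE, h2⟩ := h
  refine ⟨C.toY x y, (VariableChange.equation_iff W C x y).mpr hE, ?_⟩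
  have h := VariableChange.evalEval_polynomialY_toXY W C x y
  rw [Affine.evalEval_polynomialY, Affine.evalEval_polynomialY, h2, mul_zero] at h
  exact h

/-- **The `2`-division relation.** A rational point `(x, y)` with `2y + a₁x + a₃ = 0` on a Weierstrass
equation has `ξ = 4x` a root of `ξ³ + b₂ξ² + 8b₄ξ + 16b₆` (indeed
`4x³ + b₂x² + 2b₄x + b₆ = (2y + a₁x + a₃)² − 4·(equation) = 0`).
[cite: SilvermanAEC2009, III.1 (b₂, b₄, b₆) and III.2.3 (the 2-division polynomial)] -/
theorem cubic_eq_zero (W : WeierstrassCurve ℚ) {x y : ℚ} (heq : W.toAffine.Equation x y)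
    (h2 : 2 * y + W.a₁ * x + W.a₃ = 0) :
    (4 * x) ^ 3 + W.b₂ * (4 * x) ^ 2 + 8 * W.b₄ * (4 * x) + 16 * W.b₆ = 0 := by
  rw [WeierstrassCurve.Affine.equation_iff] at heq
  simp only [WeierstrassCurve.b₂, WeierstrassCurve.b₄, WeierstrassCurve.b₆]
  linear_combination (16 * (2 * y + W.a₁ * x + W.a₃)) * h2 - 64 * heq

/-- **Integrality of `ξ = 4x(P)`.** A rational root of the monic integer cubic
`ξ³ + b₂ξ² + 8b₄ξ + 16b₆` is an integer (integral root theorem).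
[cite: SilvermanAEC2009, VIII.7 (proof of Thm 7.1: coordinates of torsion points)] -/
theorem exists_int_eq_of_cubic (W₀ : WeierstrassCurve ℤ) {ξ : ℚ}
    (h : ξ ^ 3 + (W₀.b₂ : ℚ) * ξ ^ 2 + 8 * (W₀.b₄ : ℚ) * ξ + 16 * (W₀.b₆ : ℚ) = 0) :
    ∃ z : ℤ, (z : ℚ) = ξ := by
  have hmonic : (Polynomial.X ^ 3 + Polynomial.C W₀.b₂ * Polynomial.X ^ 2
      + Polynomial.C (8 * W₀.b₄) * Polynomial.X + Polynomial.C (16 * W₀.b₆) : Polynomial ℤ).Monic := by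
    monicity!
  have hroot : Polynomial.aeval ξ (Polynomial.X ^ 3 + Polynomial.C W₀.b₂ * Polynomial.X ^ 2
      + Polynomial.C (8 * W₀.b₄) * Polynomial.X + Polynomial.C (16 * W₀.b₆) : Polynomial ℤ) = 0 := by
    simp only [map_add, map_mul, map_pow, Polynomial.aeval_X, Polynomial.aeval_C]
    simp only [eq_intCast, Int.cast_ofNat]
    linear_combination h
  obtain ⟨z, hz⟩ := isInteger_of_is_root_of_monic hmonic hroot
  exact ⟨z, by simpa using hz⟩

/-- **The change of variables to `y² = x³ + Ax² + Bx`.** If `(x₀, y₀)` is a rational point with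
`2y₀ + a₁x₀ + a₃ = 0`, then `C = ⟨u = 1/2, r = x₀, s = −a₁/2, t = y₀⟩` transforms `W` into
`⟨0, b₂ + 3ξ, 0, 3ξ² + 2b₂ξ + 8b₄, 0⟩` with `ξ = 4x₀` (Silverman's formulas III.1 Table 3.1; the
constant term vanishes by the curve equation, `a₃'` by the `2`-torsion condition).
[cite: SilvermanAEC2009, III.1 Table 3.1] -/
theorem smul_eq_twoTorsionModel (W : WeierstrassCurve ℚ) {x₀ y₀ : ℚ}
    (heq : W.toAffine.Equation x₀ y₀) (h2 : 2 * y₀ + W.a₁ * x₀ + W.a₃ = 0) :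
    (⟨⟨1 / 2, 2, by norm_num, by norm_num⟩, x₀, -W.a₁ / 2, y₀⟩ : VariableChange ℚ) • W =
      ⟨0, W.b₂ + 3 * (4 * x₀), 0, 3 * (4 * x₀) ^ 2 + 2 * W.b₂ * (4 * x₀) + 8 * W.b₄, 0⟩ := by
  rw [WeierstrassCurve.Affine.equation_iff] at heq
  have hu : (((⟨1 / 2, 2, by norm_num, by norm_num⟩ : ℚˣ)⁻¹ : ℚˣ) : ℚ) = 2 := rfl
  ext
  · rw [variableChange_a₁, hu]; ring
  · rw [variableChange_a₂, hu]; simp only [WeierstrassCurve.b₂]; ring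
  · rw [variableChange_a₃, hu]; simp only; linear_combination 8 * h2
  · rw [variableChange_a₄, hu]; simp only [WeierstrassCurve.b₂, WeierstrassCurve.b₄]; ring
  · rw [variableChange_a₆, hu]; simp only; linear_combination (-64) * heq

/-- The discriminant of `y² = x³ + Ax² + Bx` is `16B²(A² − 4B)`. [cite: SilvermanAEC2009, III.1 (Δ in terms of b₂, b₄, b₆, b₈)] -/
theorem Δ_twoTorsionModel {R : Type*} [CommRing R] (A B : R) :
    (⟨0, A, 0, B, 0⟩ : WeierstrassCurve R).Δ = 16 * B ^ 2 * (A ^ 2 - 4 * B) := by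
  simp only [WeierstrassCurve.Δ, WeierstrassCurve.b₂, WeierstrassCurve.b₄, WeierstrassCurve.b₆,
    WeierstrassCurve.b₈]
  ring

/-- The covariant `c₄` of `y² = x³ + Ax² + Bx` is `16(A² − 3B)`. [cite: SilvermanAEC2009, III.1 (c₄ = b₂² − 24b₄)] -/
theorem c₄_twoTorsionModel {R : Type*} [CommRing R] (A B : R) :
    (⟨0, A, 0, B, 0⟩ : WeierstrassCurve R).c₄ = 16 * (A ^ 2 - 3 * B) := by
  simp only [WeierstrassCurve.c₄, WeierstrassCurve.b₂, WeierstrassCurve.b₄]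
  ring

/-- `A² − 3B = c₄` for `A = b₂ + 3ξ`, `B = 3ξ² + 2b₂ξ + 8b₄` (any `ξ`): `c₄ = b₂² − 24b₄` is
translation invariant. [cite: SilvermanAEC2009, III.1 Table 3.1 (c₄' = u⁻⁴c₄)] -/
theorem sq_sub_three_mul_eq_c₄ (W₀ : WeierstrassCurve ℤ) (ξ : ℤ) :
    (W₀.b₂ + 3 * ξ) ^ 2 - 3 * (3 * ξ ^ 2 + 2 * W₀.b₂ * ξ + 8 * W₀.b₄) = W₀.c₄ := by
  simp only [WeierstrassCurve.c₄]; ring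

/-! ## §3 Parity -/

/-- If `a₁` and `a₃` are both even then `Δ` is even (the reduction mod `2` of `y² = cubic` is
singular); contrapositively, an equation with odd discriminant has `a₁` or `a₃` odd.
[cite: SilvermanAEC2009, III.1 and A.1.1 (char. 2 normal forms)] -/
theorem odd_a₁_or_odd_a₃_of_odd_Δ (W₀ : WeierstrassCurve ℤ) (h : Odd W₀.Δ) :
    Odd W₀.a₁ ∨ Odd W₀.a₃ := by
  rcases Int.even_or_odd W₀.a₁ with ⟨s, hs⟩ | h₁
  swap
  · exact Or.inl h₁
  rcases Int.even_or_odd W₀.a₃ with ⟨t, ht⟩ | h₃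
  swap
  · exact Or.inr h₃
  exfalso
  apply Int.not_even_iff_odd.mpr h
  refine ⟨-(8 * (s * s + W₀.a₂) ^ 2 * ((s + s) ^ 2 * W₀.a₆ + 4 * W₀.a₂ * W₀.a₆
      - (s + s) * (t + t) * W₀.a₄ + W₀.a₂ * (t + t) ^ 2 - W₀.a₄ ^ 2))
      - 32 * (W₀.a₄ + (s + s) * t) ^ 3 - 216 * (t * t + W₀.a₆) ^ 2
      + 144 * (s * s + W₀.a₂) * (W₀.a₄ + (s + s) * t) * (t * t + W₀.a₆), ?_⟩
  simp only [WeierstrassCurve.Δ, WeierstrassCurve.b₂, WeierstrassCurve.b₄, WeierstrassCurve.b₆,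
    WeierstrassCurve.b₈, hs, ht]
  ring

/-- `b₂` odd iff `a₁` odd (`b₂ = a₁² + 4a₂`); and then `b₂ ≡ 1 (mod 4)`, indeed `b₂ = 8e + 4a₂ + 1`.
[cite: SilvermanAEC2009, III.1 (b₂ = a₁² + 4a₂)] -/
theorem b₂_eq_of_odd_a₁ (W₀ : WeierstrassCurve ℤ) (h : Odd W₀.a₁) :
    ∃ e : ℤ, W₀.b₂ = 8 * e + 4 * W₀.a₂ + 1 := by
  obtain ⟨s, hs⟩ := h
  obtain ⟨e, he⟩ := (Int.even_mul_succ_self s).two_dvd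
  refine ⟨e, ?_⟩
  simp only [WeierstrassCurve.b₂, hs]
  linear_combination 4 * he

/-- If `c₄ = b₂² − 24b₄` is odd then `a₁` is odd. [cite: SilvermanAEC2009, III.1 (c₄ = b₂² − 24b₄)] -/
theorem odd_a₁_of_odd_c₄ (W₀ : WeierstrassCurve ℤ) (h : Odd W₀.c₄) : Odd W₀.a₁ := by
  by_contra ha
  rw [Int.not_odd_iff_even] at ha
  obtain ⟨s, hs⟩ := ha
  apply Int.not_even_iff_odd.mpr h
  refine ⟨8 * (s * s + W₀.a₂) ^ 2 - 12 * W₀.b₄, ?_⟩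
  simp only [WeierstrassCurve.c₄, WeierstrassCurve.b₂, hs]
  ring

/-- **No rational `2`-torsion when `a₁` is even and `a₃` is odd** (good supersingular reduction at `2`):
the cubic `ξ³ + b₂ξ² + 8b₄ξ + 16b₆` has no integer root (`b₂ ≡ 0 (mod 4)`, `b₄` even, `b₆` odd:
an odd `ξ` gives an odd value; for `ξ = 2m` one gets `m³ + 2(…) = 0`, so `m = 2r`, and then `b₆`
would be even). [cite: SilvermanAEC2009, VII.3 (reduction of torsion) and A.1.1] -/
theorem no_root_of_even_a₁_odd_a₃ (W₀ : WeierstrassCurve ℤ) (ha₁ : Even W₀.a₁) (ha₃ : Odd W₀.a₃)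
    (ξ : ℤ) : ξ ^ 3 + W₀.b₂ * ξ ^ 2 + 8 * W₀.b₄ * ξ + 16 * W₀.b₆ ≠ 0 := by
  obtain ⟨s, hs⟩ := ha₁
  obtain ⟨t, ht⟩ := ha₃
  intro H
  have hb₂ : W₀.b₂ = 4 * (s * s + W₀.a₂) := by simp only [WeierstrassCurve.b₂, hs]; ring
  have hb₄ : W₀.b₄ = 2 * ((s + s) * t + s + W₀.a₄) := by
    simp only [WeierstrassCurve.b₄, hs, ht]; ring
  have hb₆ : W₀.b₆ = 4 * (t * t + t + W₀.a₆) + 1 := by simp only [WeierstrassCurve.b₆, ht]; ring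
  rcases Int.even_or_odd ξ with ⟨m, hm⟩ | hξ
  · -- `ξ = 2m`
    rw [hm, hb₂, hb₄, hb₆] at H
    have H8 : m ^ 3 + 2 * (s * s + W₀.a₂) * m ^ 2 + 4 * ((s + s) * t + s + W₀.a₄) * m
        + (8 * (t * t + t + W₀.a₆) + 2) = 0 := by
      have h8 : (8 : ℤ) * (m ^ 3 + 2 * (s * s + W₀.a₂) * m ^ 2 + 4 * ((s + s) * t + s + W₀.a₄) * m
          + (8 * (t * t + t + W₀.a₆) + 2)) = 0 := by
        linear_combination H
      exact (mul_eq_zero.mp h8).resolve_left (by norm_num)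
    have hm_even : Even m := by
      by_contra hmo
      rw [Int.not_even_iff_odd] at hmo
      have : Odd (m ^ 3 + 2 * (s * s + W₀.a₂) * m ^ 2 + 4 * ((s + s) * t + s + W₀.a₄) * m
          + (8 * (t * t + t + W₀.a₆) + 2)) :=
        ((hmo.pow.add_even ⟨(s * s + W₀.a₂) * m ^ 2, by ring⟩).add_even
          ⟨2 * ((s + s) * t + s + W₀.a₄) * m, by ring⟩).add_even
            ⟨4 * (t * t + t + W₀.a₆) + 1, by ring⟩
      rw [H8] at this
      exact (by decide : ¬ Odd (0 : ℤ)) this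
    obtain ⟨r, hr⟩ := hm_even
    rw [hr] at H8
    have h8 : (8 : ℤ) ∣ 2 :=
      ⟨-(r ^ 3 + (s * s + W₀.a₂) * r ^ 2 + ((s + s) * t + s + W₀.a₄) * r + (t * t + t + W₀.a₆)),
        by linear_combination H8⟩
    omega
  · -- `ξ` odd: the value is odd
    have hodd : Odd (ξ ^ 3 + W₀.b₂ * ξ ^ 2 + 8 * W₀.b₄ * ξ + 16 * W₀.b₆) := by
      rw [hb₂]
      refine ((hξ.pow.add_even ⟨2 * (s * s + W₀.a₂) * ξ ^ 2, by ring⟩).add_even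
        ⟨4 * W₀.b₄ * ξ, by ring⟩).add_even ⟨8 * W₀.b₆, by ring⟩
    rw [H] at hodd
    exact (by decide : ¬ Odd (0 : ℤ)) hodd

/-- **The `2`-adic dichotomy for the root.** If `b₂` is odd and `ξ` is an integer root of
`ξ³ + b₂ξ² + 8b₄ξ + 16b₆`, then `ξ ≢ 2 (mod 4)`: either `ξ` is odd, and then `8 ∣ ξ + b₂`, or
`4 ∣ ξ`. [cite: Ivorra2004, §2.1 (the 2-adic normalisation of the models with a 2-torsion point)] -/
theorem odd_or_four_dvd (b₂ b₄ b₆ ξ : ℤ) (hb : Odd b₂)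
    (H : ξ ^ 3 + b₂ * ξ ^ 2 + 8 * b₄ * ξ + 16 * b₆ = 0) :
    (Odd ξ ∧ (8 : ℤ) ∣ ξ + b₂) ∨ (4 : ℤ) ∣ ξ := by
  obtain ⟨c, hc⟩ := hb
  rcases Int.even_or_odd ξ with ⟨m, hm⟩ | hξ
  · right
    -- `ξ = 2m`; if `m` were odd, `ξ = 4k + 2` and the value is `≡ 8 + 4b₂ ≢ 0 (mod 16)`
    rcases Int.even_or_odd m with ⟨k, hk⟩ | ⟨k, hk⟩
    · exact ⟨k, by rw [hm, hk]; ring⟩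
    · exfalso
      rw [hm, hk, hc] at H
      have h16 : (16 : ℤ) ∣ 8 * c + 12 :=
        ⟨-(4 * k ^ 3 + 6 * k ^ 2 + 3 * k + (2 * c + 1) * (k ^ 2 + k) + b₄ * (2 * k + 1) + b₆),
          by linear_combination H⟩
      omega
  · left
    refine ⟨hξ, ?_⟩
    obtain ⟨m, hm⟩ := hξ
    obtain ⟨e, he⟩ := (Int.even_mul_succ_self m).two_dvd
    -- `ξ² = 8e + 1`, so the value is `(ξ + b₂)(8e + 1) + 8(b₄ξ + 2b₆)`
    have hsq : ξ ^ 2 = 8 * e + 1 := by rw [hm]; linear_combination 4 * he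
    refine ⟨-((ξ + b₂) * e + b₄ * ξ + 2 * b₆), ?_⟩
    have : ξ ^ 3 + b₂ * ξ ^ 2 + 8 * b₄ * ξ + 16 * b₆ = (ξ + b₂) * ξ ^ 2 + 8 * (b₄ * ξ + 2 * b₆) := by
      ring
    rw [this, hsq] at H
    linear_combination H

/-- **Type I.** If `b₂ = 8e + 4a₂ + 1` and `4 ∣ ξ`, then `A = b₂ + 3ξ ≡ 1 (mod 4)` and `8 ∣ B`,
`B = 3ξ² + 2b₂ξ + 8b₄`. [cite: Ivorra2004, §2.1] -/
theorem typeI (b₂ b₄ a₂ e ξ : ℤ) (hb : b₂ = 8 * e + 4 * a₂ + 1) (h4 : (4 : ℤ) ∣ ξ) :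
    (b₂ + 3 * ξ) % 4 = 1 ∧ (8 : ℤ) ∣ 3 * ξ ^ 2 + 2 * b₂ * ξ + 8 * b₄ := by
  obtain ⟨m, rfl⟩ := h4
  constructor
  · rw [hb]; omega
  · exact ⟨6 * m ^ 2 + b₂ * m + b₄, by ring⟩

/-- **Type II.** If `b₂ = 8e + 4a₂ + 1`, `ξ` is odd and `8 ∣ ξ + b₂`, then `B = 3ξ² + 2b₂ξ + 8b₄`
is odd and `A = b₂ + 3ξ = 2A₁` with `A₁ ≡ 3 (mod 4)`. [cite: Ivorra2004, §2.1] -/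
theorem typeII (b₂ b₄ a₂ e ξ : ℤ) (hb : b₂ = 8 * e + 4 * a₂ + 1) (hξ : Odd ξ)
    (h8 : (8 : ℤ) ∣ ξ + b₂) :
    Odd (3 * ξ ^ 2 + 2 * b₂ * ξ + 8 * b₄) ∧ ∃ A₁ : ℤ, b₂ + 3 * ξ = 2 * A₁ ∧ A₁ % 4 = 3 := by
  obtain ⟨w, hw⟩ := h8
  constructor
  · have h3 : Odd (3 : ℤ) := by decide
    exact ((h3.mul hξ.pow).add_even ⟨b₂ * ξ, by ring⟩).add_even ⟨4 * b₄, by ring⟩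
  · refine ⟨ξ + 4 * w, by linear_combination hw, ?_⟩
    obtain ⟨m, hm⟩ := hξ
    omega

/-! ## §4 The package -/

/-- **Normal form of an elliptic curve of prime conductor with a rational `2`-torsion point.** If
`N_E = p` is prime and `E(ℚ)` has a point of order `2`, then `E` is `ℚ`-isomorphic to
`y² = x³ + Ax² + Bx` with integers `A, B` such that `B²(A² − 4B) = ±2⁸pⁿ` for some `n ≥ 1`,
`p ∤ A² − 3B`, and either (I) `A ≡ 1 (mod 4)`, `8 ∣ B`, or (II) `B` odd, `A = 2A₁`,
`A₁ ≡ 3 (mod 4)`. (For odd `p`: `Δ_min = ±pⁿ` is odd, so `a₁` or `a₃` is odd, and the supersingular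
case `a₁` even is excluded by the `2`-torsion point; for `p = 2`: `c₄` is odd; either way `a₁` is odd,
`b₂ ≡ 1 (mod 4)`, and the dichotomy is `odd_or_four_dvd`.)
[cite: Setzer1975, §2 (the models y² = x³ + Ax² + Bx of curves of prime conductor with a 2-torsion point; statement via Ivorra2004, Introduction p. 5 and §2.1)] -/
theorem exists_normalForm_of_prime_conductorNorm (W : WeierstrassCurve ℚ) [W.IsElliptic]
    (hN : (W.conductorNorm ℤ).Prime) {x : ℚ} (hx : HasRationalTwoTorsionX W x) :
    ∃ (C : VariableChange ℚ) (A B : ℤ) (n : ℕ),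
      C • W = ⟨0, A, 0, B, 0⟩ ∧ 1 ≤ n ∧
      (B ^ 2 * (A ^ 2 - 4 * B) = 2 ^ 8 * (W.conductorNorm ℤ : ℤ) ^ n ∨
        B ^ 2 * (A ^ 2 - 4 * B) = -(2 ^ 8 * (W.conductorNorm ℤ : ℤ) ^ n)) ∧
      ¬ ((W.conductorNorm ℤ : ℕ) : ℤ) ∣ A ^ 2 - 3 * B ∧
      ((A % 4 = 1 ∧ (8 : ℤ) ∣ B) ∨ (Odd B ∧ ∃ A₁ : ℤ, A = 2 * A₁ ∧ A₁ % 4 = 3)) := by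
  obtain ⟨C₁, W₀, n, hCW, -, hn, hΔ, hc4⟩ := exists_intModel_of_prime_conductorNorm W hN
  set N := W.conductorNorm ℤ
  -- the `2`-torsion point on `W₀/ℚ`
  have hx₀ := hasRationalTwoTorsionX_smul W C₁ hx
  rw [hCW] at hx₀
  obtain ⟨y₀, heq, h2⟩ := hx₀
  set x₀ := C₁.toX x
  have hb₂ : (W₀.baseChange ℚ).b₂ = (W₀.b₂ : ℚ) := by simp [WeierstrassCurve.baseChange]
  have hb₄ : (W₀.baseChange ℚ).b₄ = (W₀.b₄ : ℚ) := by simp [WeierstrassCurve.baseChange]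
  have hb₆ : (W₀.baseChange ℚ).b₆ = (W₀.b₆ : ℚ) := by simp [WeierstrassCurve.baseChange]
  -- `ξ = 4x₀ ∈ ℤ` is a root of the cubic
  have hcubic := cubic_eq_zero (W₀.baseChange ℚ) heq h2
  rw [hb₂, hb₄, hb₆] at hcubic
  obtain ⟨ξ, hξ⟩ := exists_int_eq_of_cubic W₀ hcubic
  have hcubicZ : ξ ^ 3 + W₀.b₂ * ξ ^ 2 + 8 * W₀.b₄ * ξ + 16 * W₀.b₆ = 0 := by
    have : ((ξ ^ 3 + W₀.b₂ * ξ ^ 2 + 8 * W₀.b₄ * ξ + 16 * W₀.b₆ : ℤ) : ℚ) = 0 := by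
      push_cast; rw [hξ]; exact hcubic
    exact_mod_cast this
  -- the model `⟨0, A, 0, B, 0⟩`
  set A : ℤ := W₀.b₂ + 3 * ξ with hA
  set B : ℤ := 3 * ξ ^ 2 + 2 * W₀.b₂ * ξ + 8 * W₀.b₄ with hB
  set C₂ : VariableChange ℚ := ⟨⟨1 / 2, 2, by norm_num, by norm_num⟩, x₀, -(W₀.baseChange ℚ).a₁ / 2, y₀⟩
    with hC₂
  have hmodel : C₂ • (W₀.baseChange ℚ) = ⟨0, (A : ℚ), 0, (B : ℚ), 0⟩ := by
    rw [hC₂, smul_eq_twoTorsionModel (W₀.baseChange ℚ) heq h2, hb₂, hb₄, ← hξ, hA, hB]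
    push_cast
    ring_nf
  -- discriminant: `16 B²(A² − 4B) = 2¹² Δ(W₀)`
  have hΔmodel : (16 : ℚ) * (B : ℚ) ^ 2 * ((A : ℚ) ^ 2 - 4 * B) = 2 ^ 12 * (W₀.Δ : ℚ) := by
    have h1 := congrArg WeierstrassCurve.Δ hmodel
    rw [variableChange_Δ, Δ_twoTorsionModel, baseChange_int_Δ] at h1
    have hu : (((⟨1 / 2, 2, by norm_num, by norm_num⟩ : ℚˣ)⁻¹ : ℚˣ) : ℚ) = 2 := rfl
    rw [hC₂] at h1
    simp only [hu] at h1
    linear_combination -h1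
  have hdisc : B ^ 2 * (A ^ 2 - 4 * B) = 2 ^ 8 * W₀.Δ := by
    have : ((B ^ 2 * (A ^ 2 - 4 * B) : ℤ) : ℚ) = ((2 ^ 8 * W₀.Δ : ℤ) : ℚ) := by
      push_cast; linear_combination hΔmodel / 16
    exact_mod_cast this
  -- `A² − 3B = c₄`
  have hc4' : ¬ (N : ℤ) ∣ A ^ 2 - 3 * B := by rw [hA, hB, sq_sub_three_mul_eq_c₄]; exact hc4
  -- `a₁` is odd
  have ha₁odd : Odd W₀.a₁ := by
    by_cases hN2 : N = 2
    · -- `p = 2`: `c₄` is odd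
      apply odd_a₁_of_odd_c₄
      rw [hN2] at hc4
      rw [← Int.not_even_iff_odd, even_iff_two_dvd]
      exact_mod_cast hc4
    · have hNodd : Odd (N : ℤ) := by exact_mod_cast hN.odd_of_ne_two hN2
      have hΔodd : Odd W₀.Δ := by
        rcases hΔ with h | h <;> rw [h]
        · exact hNodd.pow
        · exact hNodd.pow.neg
      rcases odd_a₁_or_odd_a₃_of_odd_Δ W₀ hΔodd with h | h
      · exact h
      · by_contra hev
        rw [Int.not_odd_iff_even] at hev
        exact no_root_of_even_a₁_odd_a₃ W₀ hev h ξ hcubicZ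
  obtain ⟨e, he⟩ := b₂_eq_of_odd_a₁ W₀ ha₁odd
  have hb₂odd : Odd W₀.b₂ := ⟨4 * e + 2 * W₀.a₂, by rw [he]; ring⟩
  refine ⟨C₂ * C₁, A, B, n, ?_, hn, ?_, hc4', ?_⟩
  · rw [mul_smul, hCW, hmodel]
  · rcases hΔ with h | h
    · left; rw [hdisc, h]
    · right; rw [hdisc, h]; ring
  · rcases odd_or_four_dvd W₀.b₂ W₀.b₄ W₀.b₆ ξ hb₂odd hcubicZ with ⟨hξodd, h8⟩ | h4
    · right
      exact typeII W₀.b₂ W₀.b₄ W₀.a₂ e ξ he hξodd h8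
    · left
      exact typeI W₀.b₂ W₀.b₄ W₀.a₂ e ξ he h4

end PrimeConductorTwoTorsion

end Literature.NumberTheory.EllipticCurves
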